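import Literature.NumberTheory.Sieve.SieveFrameworkFundamentalLemma
import HarnessLib

/-!
# The upper `β`-sieve main term for signed densities: `∑_{d ∣ P} λ_d g(d) = V(P)(1 + O(∑_r 2^{−Ar} ∏_{z_r ≤ p < z} (1 + 4/p)(1 + 2^{A+1}/p)))`

Topic `Literature/NumberTheory/Sieve`, namespace `BetaSieve` (continuing
`SieveFrameworkFundamentalLemma.lean`, whose `BetaSieve.mainTerm_identity` is the algebraic identity
`∑_{d ∣ P} μ(d) χ(d) g(d) = V(P) − ∑_{t ∣ P} μ(t) χ̄(t) g(t) V(P; q(t))` for ANY multiplicative `g`,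
and whose `BetaSieve.bdry_props` gives the level/boundary properties of Rosser's truncation sets).
Everything in this file is PROVED (theorems only).

The tree's `BetaSieve.abs_mainTerm_sub_le` / `bdry_sum_le` treat sieve DENSITIES (`0 ≤ g(p) ≤ 1` of
dimension `κ`). Matomäki–Merikoski, arXiv:2112.11412, Lemma 3.2 (ii), need the main-term estimate for
SIGNED multiplicative `g` with `|g(p)| ≤ 2/p` (applied in §6 with `g(d) = λ_L(d)/d`, `g(p) = −1/p`):
"If `g : ℕ → [−1, 1]` is a multiplicative function for which `|g(p)| ≤ 2/p` for every prime `p`, then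
`∑_{d ∣ P(z)} λ_d g(d) = (1 + O_{β,A}(e^{−Aθu/2})) ∏_{p < z} (1 − g(p))`." We prove the structural
bound behind it, for the upper weights `λ_d = μ(d)χ⁺(d)` (`χ⁺ = ind 1 β D`), any squarefree `P` with
prime factors `< z`, `β > 1`, `1 < z ≤ D^{1/β}`:

  `|∑_{d ∣ P} λ_d g(d) − V(P)| ≤ V(P) ∑_{1 ≤ r ≤ ω(P), log D < (r + β) log z}
      2^{−Ar} ∏_{p ∣ P, p ≥ z^{θ^r}} (1 + 4/p)(1 + 2^{A+1}/p)`,   `θ = 1 − 1/β`, `V(P) = ∏_{p ∣ P}(1 − g(p))`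

(`BetaSieve.abs_sum_weights_mul_sub_vprod_le`), under the additional hypothesis `g(p) ≤ 1/2` on the
prime factors of `P`, which guarantees `1 − g(p) ≥ 1/2 > 0` (the printed relative-error form is void
when some `1 − g(p)` vanishes, e.g. `g(p) = 2/p` at `p = 2`; in the applications `g(p) ≤ 0` or `p` is
large). This is exactly the printed argument: "As in (i), only `r ≥ uθ − β` contribute and
`p_r ≥ z_r`. Hence, writing `m = p₁ ⋯ p_r` and using again `1 ≤ 2^{A(ω(m)−r)}`, we obtain
`V_r(z) ≤ ∏_{p<z}(1 − g(p)) ∏_{z_r ≤ p ≤ z}(1 + |g(p)|) ∑_{m : p ∣ m ⇒ z_r ≤ p < z} 2^{A(ω(m)−r)} |μ(m)| g(m)`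
… `≤ 2^{−Ar} ∏_{p<z}(1 − g(p)) ∏_{z_r ≤ p ≤ z}(1 + 2/p)(1 + 2^{A+1}/p)`" (our `1 + 4/p` absorbs the
division by `1 − g(p) ≥ 1/2`); the remaining steps of the source ("`≪ 2^{−Ar}(log z/log z_r)^{2^{A+1}+2}`
… `≪_{β,A} e^{−Auθ/2}`") are Mertens' theorem and a geometric sum, left to the consumer with its
own `β`, `A`.

* `BetaSieve.pred_of_bdry_ne_zero`, `BetaSieve.rpow_le_of_bdry_ne_zero` — a boundary term `t ∣ P`
  (`χ̄⁺(t) ≠ 0`) has `log D < (ω(t) + β) log z` and all its prime factors `≥ z^{θ^{ω(t)}}`;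
* `BetaSieve.abs_vlt_le` — `|V(P; q(t))| ≤ V(P) ∏_{p ∣ P, p ≥ z^{θ^r}} (1 + 4/p)` for such `t`;
* `BetaSieve.sum_abs_le_rankin_two_pow` — Rankin's trick with `λ = 2^A`:
  `∑_{t ∈ C} |g(t)| ≤ 2^{−AN} ∏_{p ∈ S} (1 + 2^A |g(p)|)` over squarefree `t` with `N` prime factors from `S`;
* `BetaSieve.abs_sum_weights_mul_sub_vprod_le` — the displayed bound (Lemma 3.2 (ii)).

## References

* K. Matomäki, J. Merikoski, *Siegel zeros, twin primes, Goldbach's conjecture, and primes in short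
  intervals*, IMRN 2023 (arXiv:2112.11412), Lemma 3.2 (ii) and its proof (§3.2).
  [cite: MatomakiMerikoski2023, Lemma 3.2 (ii)]
* G. Greaves, *Sieves in Number Theory*, Springer (2001), §3.1.4 Lemma 4 and §3.3.3 Lemmas 2–4.
  [cite: Greaves2001, §3.1.4 Lemma 4]
-/

open Finset
open scoped ArithmeticFunction.Moebius

noncomputable section

namespace Literature.NumberTheory.Sieve

namespace BetaSieve

variable {par : ℕ} {β D : ℝ} {g : ArithmeticFunction ℝ}

/-! ### Boundary terms -/

/-- `χ̄(t) ≠ 0` unpacks to `χ(t/q(t)) = 1`, `χ(t) = 0`. [folklore] -/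
theorem pred_of_bdry_ne_zero {t : ℕ} (h : bdry par β D t ≠ 0) :
    pred par β D (t / t.minFac) ∧ ¬ pred par β D t := by
  classical
  by_contra hcon
  apply h
  unfold bdry
  rw [if_neg hcon]

/-- `χ̄(t) ≠ 0` forces `χ̄(t) = 1` and `t ≠ 1`. [folklore] -/
theorem bdry_eq_one_of_ne_zero {t : ℕ} (h : bdry par β D t ≠ 0) : bdry par β D t = 1 ∧ t ≠ 1 := by
  classical
  refine ⟨?_, fun h1 => h (by rw [h1, bdry_one])⟩
  unfold bdry at h ⊢
  split_ifs at h ⊢ with hc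
  · rfl
  · exact absurd rfl h

/-- **Boundary terms live on large primes** ("`p_r ≥ z_r`"): for `β > 1`, `1 < z`, `1 < D`,
`β log z ≤ log D` and a squarefree `t` with prime factors `< z` and `χ̄(t) ≠ 0`, every prime factor
`p` of `t` satisfies `z^{(1−1/β)^{ω(t)}} ≤ p`, and `log D < (ω(t) + β) log z`.
[cite: MatomakiMerikoski2023, §3.2 (proof of Lemma 3.2)] -/
theorem rpow_le_of_bdry_ne_zero (hβ : 1 < β) {z : ℝ} (hz : 1 < z) (hD1 : 1 < D)
    (hzD : β * Real.log z ≤ Real.log D) {t : ℕ} (ht : Squarefree t)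
    (hpz : ∀ p ∈ t.primeFactors, (p : ℝ) < z) (hb : bdry par β D t ≠ 0) :
    (∀ p ∈ t.primeFactors, z ^ ((1 - 1 / β) ^ t.primeFactors.card) ≤ (p : ℝ)) ∧
      Real.log D < (t.primeFactors.card + β) * Real.log z := by
  obtain ⟨h', h⟩ := pred_of_bdry_ne_zero hb
  have h1 : t ≠ 1 := (bdry_eq_one_of_ne_zero hb).2
  have hq := Nat.minFac_prime h1
  obtain ⟨hlog, hD⟩ := bdry_props hβ hz hD1 hzD ht hpz h' h
  refine ⟨fun p hp => ?_, hD⟩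
  have hz0 : 0 < z := by linarith
  have hqp : t.minFac ≤ p :=
    Nat.minFac_le_of_dvd (Nat.prime_of_mem_primeFactors hp).two_le (Nat.dvd_of_mem_primeFactors hp)
  have h2 : Real.log t.minFac ≤ Real.log p :=
    Real.log_le_log (by exact_mod_cast hq.pos) (by exact_mod_cast hqp)
  have h3 : z ^ ((1 - 1 / β) ^ t.primeFactors.card) = Real.exp ((1 - 1 / β) ^ t.primeFactors.card *
      Real.log z) := by
    rw [Real.rpow_def_of_pos hz0, mul_comm]
  rw [h3, ← Real.exp_log (by exact_mod_cast (Nat.prime_of_mem_primeFactors hp).pos : (0 : ℝ) < p)]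
  exact Real.exp_le_exp.mpr (hlog.trans h2)

/-! ### The partial products `V(P; q)` for signed `g` -/

/-- `V(P) ≥ 0` when `g(p) ≤ 1` on the prime factors of `P` (no sign condition on `g`). [folklore] -/
theorem vprod_nonneg_of_le_one {P : ℕ} (h1 : ∀ p ∈ P.primeFactors, g p ≤ 1) : 0 ≤ vprod g P :=
  Finset.prod_nonneg fun p hp => sub_nonneg.mpr (h1 p hp)

/-- **`|V(P; q(t))| ≤ V(P) ∏_{p ∣ P, p ≥ w} (1 + 4/p)`** whenever `w ≤ q` and, on the prime factors of
`P`, `|g(p)| ≤ 2/p` and `g(p) ≤ 1/2` (so that `(1 − g(p))⁻¹ ≤ 1 + 4/p`): the division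
`V(P; q) = V(P)/∏_{p ∣ P, p ≥ q}(1 − g(p))` of the source ("`∏_{p < p_r}(1−g(p)) =
∏_{p<z}(1−g(p)) ∏_{p_r ≤ p < z} (1 − g(p))⁻¹`"). [cite: MatomakiMerikoski2023, §3.2 (proof of Lemma 3.2 (ii))] -/
theorem abs_vlt_le {P : ℕ} (hgp : ∀ p ∈ P.primeFactors, |g p| ≤ 2 / p ∧ g p ≤ 1 / 2)
    {w : ℝ} {q : ℕ} (hwq : w ≤ q) :
    |vlt g P q| ≤ vprod g P * ∏ p ∈ P.primeFactors.filter (fun p : ℕ => w ≤ (p : ℝ)), (1 + 4 / (p : ℝ)) := by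
  have hfac : ∀ p ∈ P.primeFactors, 1 / 2 ≤ 1 - g p ∧ (1 - g p)⁻¹ ≤ 1 + 4 / (p : ℝ) := by
    intro p hp
    obtain ⟨habs, hle⟩ := hgp p hp
    have hp0 : (0 : ℝ) < p := by exact_mod_cast (Nat.prime_of_mem_primeFactors hp).pos
    refine ⟨by linarith, ?_⟩
    have h1 : 0 < 1 - g p := by linarith
    rw [inv_le_comm₀ h1 (by positivity)]
    -- `1/(1 + 4/p) ≤ 1 − g(p)` iff `1 ≤ (1 − g(p))(1 + 4/p)`: for `p ≥ 4` use `g(p) ≤ 2/p`, else `g(p) ≤ 1/2`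
    have hg2 : g p ≤ 2 / p := (le_abs_self _).trans habs
    rw [inv_eq_one_div, div_le_iff₀ (by positivity)]
    set a : ℝ := 4 / (p : ℝ) with ha
    have ha0 : 0 ≤ a := by positivity
    have hga : g p ≤ a / 2 := by rw [ha]; linarith [show (2 : ℝ) / p = 4 / p / 2 by ring]
    by_cases hp4 : (4 : ℝ) ≤ p
    · have ha1 : a ≤ 1 := by rw [ha, div_le_one hp0]; exact hp4
      nlinarith [mul_le_mul_of_nonneg_right hga ha0, mul_nonneg (sub_nonneg.mpr ha1) ha0]
    · have ha1 : 1 ≤ a := by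
        rw [ha, le_div_iff₀ hp0]; linarith
      nlinarith [mul_le_mul_of_nonneg_right (by linarith : 1 / 2 ≤ 1 - g p) (by linarith : 0 ≤ 1 + a)]
  -- `V(P) = V(P; q) · W`, `W = ∏_{p ∣ P, p ≥ q} (1 − g p) > 0`, `W⁻¹ ≤ ∏_{p ≥ q} (1 + 4/p) ≤ ∏_{p ≥ w} (1 + 4/p)`
  set W : ℝ := ∏ p ∈ P.primeFactors.filter (fun p => ¬ p < q), (1 - g p) with hW
  have hWpos : 0 < W := Finset.prod_pos fun p hp => by
    have := (hfac p (Finset.mem_filter.mp hp).1).1; linarith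
  have hV : vprod g P = vlt g P q * W := vprod_eq_vlt_mul q
  have hV0 : 0 ≤ vprod g P := vprod_nonneg_of_le_one fun p hp => by linarith [(hgp p hp).2]
  have hvlt : vlt g P q = vprod g P * W⁻¹ := by
    rw [hV, mul_assoc, mul_inv_cancel₀ hWpos.ne', mul_one]
  have hvlt0 : 0 ≤ vlt g P q := by rw [hvlt]; exact mul_nonneg hV0 (inv_nonneg.mpr hWpos.le)
  rw [abs_of_nonneg hvlt0, hvlt]
  refine mul_le_mul_of_nonneg_left ?_ hV0
  -- `W⁻¹ ≤ ∏_{p ≥ q} (1 + 4/p) ≤ ∏_{p ≥ w} (1 + 4/p)`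
  have hWinv : W⁻¹ = ∏ p ∈ P.primeFactors.filter (fun p => ¬ p < q), (1 - g p)⁻¹ := by
    rw [hW, Finset.prod_inv_distrib]
  rw [hWinv]
  calc ∏ p ∈ P.primeFactors.filter (fun p => ¬ p < q), (1 - g p)⁻¹
      ≤ ∏ p ∈ P.primeFactors.filter (fun p => ¬ p < q), (1 + 4 / (p : ℝ)) :=
        Finset.prod_le_prod (fun p hp => by
            have := (hfac p (Finset.mem_filter.mp hp).1).1
            exact inv_nonneg.mpr (by linarith))
          fun p hp => (hfac p (Finset.mem_filter.mp hp).1).2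
    _ ≤ ∏ p ∈ P.primeFactors.filter (fun p : ℕ => w ≤ (p : ℝ)), (1 + 4 / (p : ℝ)) := by
        refine Finset.prod_le_prod_of_subset_of_one_le ?_ (fun p _ => by positivity) (fun p _ _ => by
          have : (0 : ℝ) ≤ 4 / (p : ℝ) := by positivity
          linarith)
        intro p hp
        rw [Finset.mem_filter] at hp ⊢
        refine ⟨hp.1, hwq.trans ?_⟩
        exact_mod_cast not_lt.mp hp.2

/-! ### Rankin's trick with `λ = 2^A` -/

/-- `|g(t)| = ∏_{p ∣ t} |g(p)|` for multiplicative `g` and squarefree `t`. [folklore] -/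
theorem abs_map_eq_prod_primeFactors (hg : g.IsMultiplicative) {t : ℕ} (ht : Squarefree t) :
    |g t| = ∏ p ∈ t.primeFactors, |g p| := by
  rw [map_eq_prod_primeFactors hg ht, Finset.abs_prod]

/-- **Rankin's trick with `λ = 2^A`** ("using again `1 ≤ 2^{A(ω(m) − r)}`"): for multiplicative `g` and
a finite set `C` of squarefree numbers each composed of exactly `N` primes from `S`,
`∑_{t ∈ C} |g(t)| ≤ (∏_{p ∈ S} (1 + 2^A |g(p)|)) / 2^{AN}`. [cite: MatomakiMerikoski2023, §3.2 (proof of Lemma 3.2 (ii))] -/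
theorem sum_abs_le_rankin_two_pow (hg : g.IsMultiplicative) (S : Finset ℕ) (A N : ℕ)
    (C : Finset ℕ) (hC : ∀ t ∈ C, Squarefree t ∧ t.primeFactors ⊆ S ∧ t.primeFactors.card = N) :
    ∑ t ∈ C, |g t| ≤ (∏ p ∈ S, (1 + 2 ^ A * |g p|)) / 2 ^ (A * N) := by
  classical
  have hinj : Set.InjOn (fun t : ℕ => t.primeFactors) C := by
    intro t₁ h₁ t₂ h₂ heq
    have e₁ := Nat.prod_primeFactors_of_squarefree (hC t₁ h₁).1
    have e₂ := Nat.prod_primeFactors_of_squarefree (hC t₂ h₂).1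
    rw [← e₁, ← e₂]
    exact congrArg (fun T : Finset ℕ => ∏ p ∈ T, p) heq
  have himg : C.image (fun t : ℕ => t.primeFactors) ⊆ S.powersetCard N := by
    intro T hT
    rw [Finset.mem_image] at hT
    obtain ⟨t, ht, rfl⟩ := hT
    exact Finset.mem_powersetCard.mpr ⟨(hC t ht).2.1, (hC t ht).2.2⟩
  calc ∑ t ∈ C, |g t| = ∑ t ∈ C, ∏ p ∈ t.primeFactors, |g p| :=
        Finset.sum_congr rfl fun t ht => abs_map_eq_prod_primeFactors hg (hC t ht).1
    _ = ∑ T ∈ C.image (fun t : ℕ => t.primeFactors), ∏ p ∈ T, |g p| :=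
        (Finset.sum_image (f := fun T : Finset ℕ => ∏ p ∈ T, |g p|) hinj).symm
    _ ≤ ∑ T ∈ S.powersetCard N, ∏ p ∈ T, |g p| :=
        Finset.sum_le_sum_of_subset_of_nonneg himg fun T _ _ =>
          Finset.prod_nonneg fun p _ => abs_nonneg _
    _ ≤ (∏ p ∈ S, (1 + 2 ^ A * |g p|)) / (2 ^ A) ^ N :=
        sum_powersetCard_prod_le S (fun p => |g p|) (fun p _ => abs_nonneg _) (by positivity) N
    _ = (∏ p ∈ S, (1 + 2 ^ A * |g p|)) / 2 ^ (A * N) := by rw [← pow_mul]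

/-! ### Lemma 3.2 (ii) -/

/-- **Matomäki–Merikoski 2023, Lemma 3.2 (ii)** (upper `β`-sieve main term for a signed density,
structural form). Let `β > 1`, `1 < z`, `1 < D`, `β log z ≤ log D`; let `P` be squarefree with all
prime factors `< z` (e.g. `P = P(z)`), and `g` multiplicative with `|g(p)| ≤ 2/p` and `g(p) ≤ 1/2` for
`p ∣ P`. Then with `λ_d = μ(d) χ⁺(d)` (`χ⁺ = BetaSieve.ind 1 β D`), `V(P) = ∏_{p ∣ P} (1 − g(p))`,
`θ = 1 − 1/β`:
`|∑_{d ∣ P} λ_d g(d) − V(P)| ≤ V(P) ∑_{1 ≤ r ≤ ω(P), log D < (r + β) log z}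
  2^{−Ar} ∏_{p ∣ P, p ≥ z^{θ^r}} (1 + 4/p)(1 + 2^{A+1}/p)`.
(The printed statement, "`∑_{d ∣ P(z)} λ_d g(d) = (1 + O_{β,A}(e^{−Aθu/2})) ∏_{p<z}(1 − g(p))`" for
`D = X^θ`, `z = X^{1/u}`, `u ≥ β/θ`, follows by Mertens' theorem:
`∏_{z_r ≤ p < z}(1 + c/p) ≪ (log z/log z_r)^c = (β/(β−1))^{rc}`, and summing the geometric series over
`r > uθ − β` with `β` large in terms of `A`.) [cite: MatomakiMerikoski2023, Lemma 3.2 (ii)] -/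
theorem abs_sum_weights_mul_sub_vprod_le (hβ : 1 < β) {z : ℝ} (hz : 1 < z) (hD1 : 1 < D)
    (hzD : β * Real.log z ≤ Real.log D) (hg : g.IsMultiplicative)
    {P : ℕ} (hP : Squarefree P) (hpz : ∀ p ∈ P.primeFactors, (p : ℝ) < z)
    (hgp : ∀ p ∈ P.primeFactors, |g p| ≤ 2 / p ∧ g p ≤ 1 / 2) (A : ℕ) :
    |∑ d ∈ P.divisors, (μ d : ℝ) * ind 1 β D d * g d - vprod g P| ≤
      vprod g P * ∑ r ∈ Icc 1 P.primeFactors.card,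
        (if Real.log D < ((r : ℕ) + β) * Real.log z then
          (∏ p ∈ P.primeFactors.filter (fun p : ℕ => z ^ ((1 - 1 / β) ^ r) ≤ (p : ℝ)),
              ((1 + 4 / (p : ℝ)) * (1 + 2 ^ (A + 1) / (p : ℝ)))) / 2 ^ (A * r)
          else 0) := by
  classical
  have hP0 : P ≠ 0 := hP.ne_zero
  have hV0 : 0 ≤ vprod g P := vprod_nonneg_of_le_one fun p hp => by linarith [(hgp p hp).2]
  -- Step 0: the identity and the triangle inequality
  rw [mainTerm_identity hg hP, sub_sub_cancel_left, abs_neg]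
  set F : ℕ → ℝ := fun t => bdry 1 β D t * |g t| * |vlt g P t.minFac| with hF
  have hF0 : ∀ t, 0 ≤ F t := fun t => mul_nonneg (mul_nonneg (bdry_nonneg t) (abs_nonneg _)) (abs_nonneg _)
  have htri : |∑ t ∈ P.divisors, (μ t : ℝ) * bdry 1 β D t * g t * vlt g P t.minFac| ≤
      ∑ t ∈ P.divisors, F t := by
    refine (Finset.abs_sum_le_sum_abs _ _).trans (Finset.sum_le_sum fun t _ => ?_)
    have hμ : |(μ t : ℝ)| ≤ 1 := by exact_mod_cast ArithmeticFunction.abs_moebius_le_one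
    rw [abs_mul, abs_mul, abs_mul, abs_of_nonneg (bdry_nonneg t)]
    calc |(μ t : ℝ)| * bdry 1 β D t * |g t| * |vlt g P t.minFac|
        = |(μ t : ℝ)| * (bdry 1 β D t * |g t| * |vlt g P t.minFac|) := by ring
      _ ≤ 1 * (bdry 1 β D t * |g t| * |vlt g P t.minFac|) := mul_le_mul_of_nonneg_right hμ (hF0 t)
      _ = F t := by rw [hF]; ring
  refine htri.trans ?_
  -- Step 1: insert the grouping by `r = ω(t)`
  set S : ℕ → Finset ℕ := fun r => P.primeFactors.filter (fun p : ℕ => z ^ ((1 - 1 / β) ^ r) ≤ (p : ℝ))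
    with hSdef
  have hFle : ∀ t ∈ P.divisors, F t ≤ ∑ r ∈ Icc 1 P.primeFactors.card,
      (if t.primeFactors.card = r then F t else 0) := by
    intro t ht
    by_cases hb : bdry 1 β D t = 0
    · have : F t = 0 := by rw [hF]; simp [hb]
      rw [this]
      exact Finset.sum_nonneg fun r _ => by split_ifs <;> simp
    · have h1 : t ≠ 1 := (bdry_eq_one_of_ne_zero hb).2
      have htP : t ∣ P := Nat.dvd_of_mem_divisors ht
      have hmem : t.primeFactors.card ∈ Icc 1 P.primeFactors.card := by
        rw [mem_Icc]
        refine ⟨Finset.one_le_card.mpr ?_, Finset.card_le_card (Nat.primeFactors_mono htP hP0)⟩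
        exact ⟨t.minFac, Nat.mem_primeFactors.mpr ⟨Nat.minFac_prime h1, Nat.minFac_dvd t,
          (hP.squarefree_of_dvd htP).ne_zero⟩⟩
      rw [← Finset.add_sum_erase _ _ hmem, if_pos rfl]
      have : 0 ≤ ∑ r ∈ (Icc 1 P.primeFactors.card).erase t.primeFactors.card,
          (if t.primeFactors.card = r then F t else 0) :=
        Finset.sum_nonneg fun r _ => by split_ifs <;> [exact hF0 t; exact le_rfl]
      linarith
  refine (Finset.sum_le_sum hFle).trans ?_
  rw [Finset.sum_comm, Finset.mul_sum]
  refine Finset.sum_le_sum fun r hr => ?_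
  -- Step 2: the terms with `ω(t) = r`
  rw [← Finset.sum_filter]
  -- every contributing `t` is a boundary term with `ω(t) = r`: conditions
  have hcontrib : ∀ t ∈ P.divisors.filter (fun t => t.primeFactors.card = r), F t ≠ 0 →
      Real.log D < ((r : ℕ) + β) * Real.log z ∧ t.primeFactors ⊆ S r ∧
        F t ≤ |g t| * (vprod g P * ∏ p ∈ S r, (1 + 4 / (p : ℝ))) := by
    intro t ht hFt
    rw [Finset.mem_filter] at ht
    obtain ⟨htd, htr⟩ := ht
    have htP : t ∣ P := Nat.dvd_of_mem_divisors htd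
    have htsq : Squarefree t := hP.squarefree_of_dvd htP
    have hpzt : ∀ p ∈ t.primeFactors, (p : ℝ) < z := fun p hp =>
      hpz p (Nat.primeFactors_mono htP hP0 hp)
    have hb : bdry 1 β D t ≠ 0 := by
      intro hb; apply hFt; rw [hF]; simp [hb]
    obtain ⟨hge, hD⟩ := rpow_le_of_bdry_ne_zero hβ hz hD1 hzD htsq hpzt hb
    rw [htr] at hge hD
    have h1 : t ≠ 1 := (bdry_eq_one_of_ne_zero hb).2
    refine ⟨by exact_mod_cast hD, fun p hp => ?_, ?_⟩
    · rw [hSdef, Finset.mem_filter]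
      exact ⟨Nat.primeFactors_mono htP hP0 hp, hge p hp⟩
    · -- `F t = |g t| · |V(P; q(t))|` with `χ̄ = 1`, and `q(t) ≥ z^{θ^r}`
      have hq : z ^ ((1 - 1 / β) ^ r) ≤ (t.minFac : ℝ) :=
        hge _ (Nat.mem_primeFactors.mpr ⟨Nat.minFac_prime h1, Nat.minFac_dvd t, htsq.ne_zero⟩)
      have hv := abs_vlt_le hgp hq
      rw [hF]
      simp only
      rw [(bdry_eq_one_of_ne_zero hb).1, one_mul]
      exact mul_le_mul_of_nonneg_left hv (abs_nonneg _)
  by_cases hcond : Real.log D < ((r : ℕ) + β) * Real.log z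
  · -- Step 3: Rankin over `C = {t ∣ P : ω(t) = r, t.primeFactors ⊆ S r}`
    have hsum : ∑ t ∈ P.divisors.filter (fun t => t.primeFactors.card = r), F t ≤
        (vprod g P * ∏ p ∈ S r, (1 + 4 / (p : ℝ))) *
          ∑ t ∈ (P.divisors.filter (fun t => t.primeFactors.card = r)).filter
            (fun t => t.primeFactors ⊆ S r), |g t| := by
      rw [Finset.mul_sum]
      calc ∑ t ∈ P.divisors.filter (fun t => t.primeFactors.card = r), F t
          = ∑ t ∈ (P.divisors.filter (fun t => t.primeFactors.card = r)).filter
              (fun t => t.primeFactors ⊆ S r), F t := by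
            symm
            refine Finset.sum_filter_of_ne fun t ht hne => ?_
            exact (hcontrib t ht hne).2.1
        _ ≤ _ := Finset.sum_le_sum fun t ht => by
            rw [Finset.mem_filter] at ht
            by_cases hFt : F t = 0
            · rw [hFt]; positivity
            · have := (hcontrib t ht.1 hFt).2.2
              linarith
    have hC : ∀ t ∈ (P.divisors.filter (fun t => t.primeFactors.card = r)).filter
        (fun t => t.primeFactors ⊆ S r),
        Squarefree t ∧ t.primeFactors ⊆ S r ∧ t.primeFactors.card = r := by
      intro t ht
      simp only [Finset.mem_filter] at ht
      exact ⟨hP.squarefree_of_dvd (Nat.dvd_of_mem_divisors ht.1.1), ht.2, ht.1.2⟩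
    have hrank := sum_abs_le_rankin_two_pow hg (S r) A r _ hC
    have hSfac : ∏ p ∈ S r, (1 + 2 ^ A * |g p|) ≤ ∏ p ∈ S r, (1 + 2 ^ (A + 1) / (p : ℝ)) := by
      refine Finset.prod_le_prod (fun p _ => by positivity) fun p hp => ?_
      have hp' := (Finset.mem_filter.mp hp).1
      have := (hgp p hp').1
      have hp0 : (0 : ℝ) < p := by exact_mod_cast (Nat.prime_of_mem_primeFactors hp').pos
      calc 1 + 2 ^ A * |g p| ≤ 1 + 2 ^ A * (2 / p) := by gcongr
        _ = 1 + 2 ^ (A + 1) / (p : ℝ) := by rw [pow_succ]; ring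
    have hQ0 : 0 ≤ ∏ p ∈ S r, (1 + 4 / (p : ℝ)) := Finset.prod_nonneg fun p _ => by positivity
    rw [if_pos hcond]
    calc ∑ t ∈ P.divisors.filter (fun t => t.primeFactors.card = r), F t
        ≤ (vprod g P * ∏ p ∈ S r, (1 + 4 / (p : ℝ))) *
            ((∏ p ∈ S r, (1 + 2 ^ A * |g p|)) / 2 ^ (A * r)) :=
          hsum.trans (mul_le_mul_of_nonneg_left hrank (mul_nonneg hV0 hQ0))
      _ ≤ (vprod g P * ∏ p ∈ S r, (1 + 4 / (p : ℝ))) *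
            ((∏ p ∈ S r, (1 + 2 ^ (A + 1) / (p : ℝ))) / 2 ^ (A * r)) :=
          mul_le_mul_of_nonneg_left (div_le_div_of_nonneg_right hSfac (by positivity))
            (mul_nonneg hV0 hQ0)
      _ = vprod g P * ((∏ p ∈ S r, ((1 + 4 / (p : ℝ)) * (1 + 2 ^ (A + 1) / (p : ℝ)))) /
            2 ^ (A * r)) := by rw [Finset.prod_mul_distrib]; ring
  · -- no boundary term with `ω(t) = r`
    have hzero : ∀ t ∈ P.divisors.filter (fun t => t.primeFactors.card = r), F t = 0 := by
      intro t ht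
      by_contra hne
      exact hcond (hcontrib t ht hne).1
    rw [Finset.sum_eq_zero hzero, if_neg hcond, mul_zero]

end BetaSieve

end Literature.NumberTheory.Sieve
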